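import Literature.Geometry.Kaehler.FubiniStudy
import HarnessLib

/-!
# A closed positive real `(1,1)`-form is the Kähler form of a Kähler metric (explicit form)

Layer `Literature/Geometry/Kaehler`. The theorem `isKaehlerManifold_of_closed_positive_form` of
`FubiniStudy` (Part 3) proves that a complex manifold carrying a smooth closed real `2`-form `θ` which
is `J`-invariant and positive is a Kähler manifold, by exhibiting the smooth Hermitian metric
`g(v, w) = θ(v, Jw)` whose Kähler form is `θ` — but it only records the conclusion
`IsKaehlerManifold E M` (existence of SOME Kähler metric). This file records the sharper output of the
same construction, needed whenever the Kähler CLASS matters (e.g. `[θ]ⁿ ≠ 0` for the restricted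
Fubini–Study form `θ` of a projective manifold, via `kaehlerFormPow_deRhamCohomology_mk_ne_zero`):

* `exists_isKaehler_kaehlerForm_eq_of_closed_positive_form` — **there is a smooth Kähler metric `g`
  on `M` WITH KÄHLER FORM `θ`** (Voisin (2002), §3.1.1, Lemma 3.3 and the lines after (3.1): the
  `J`-invariant symmetric forms `g` and the real `(1,1)`-forms `ω` correspond by `g(u, v) = ω(u, Iv)`,
  `ω(u, v) = g(Iu, v)`; §3.1.2 Def. 3.6).

The proof is the construction of `FubiniStudy`, verbatim, with the identity `ω_g = θ` exported.
PROVED; no definitions, no named facts.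

## References

* C. Voisin, *Hodge Theory and Complex Algebraic Geometry I* (CUP 2002), §3.1.1 Lemma 3.3, §3.1.2
  Def. 3.6. [VoisinHodgeI2002]
* P. Griffiths, J. Harris, *Principles of Algebraic Geometry* (1978), pp. 27–29, 106–109.
-/

noncomputable section

open scoped ComplexConjugate InnerProductSpace ContDiff Topology Manifold
open Complex ContinuousLinearMap Bundle Set Filter

namespace Literature.Geometry.Kaehler

variable {E : Type*} [NormedAddCommGroup E] [NormedSpace ℂ E]
  {M : Type*} [TopologicalSpace M] [ChartedSpace E M]
  [FiniteDimensional ℂ E] [IsManifold 𝓘(ℂ, E) ω M] [IsManifold 𝓘(ℝ, E) ∞ M]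

/-- **A closed, smooth, positive real `(1,1)`-form is the Kähler form of a Kähler metric — with the
metric exhibited.** Let `θ` be a smooth closed real `2`-form on the complex manifold `M` which is
`J`-invariant (`θ(Jv, Jw) = θ(v, w)`) and positive (`θ(v, Jv) > 0` for `v ≠ 0`). Then there is a
smooth Riemannian metric `g` on the real tangent bundle (namely `g(v, w) = θ(v, Jw)`) which is Kähler
and whose Kähler form IS `θ` (Voisin (2002), §3.1.1, Lemma 3.3 and the lines after (3.1); §3.1.2
Def. 3.6). Same construction as `isKaehlerManifold_of_closed_positive_form`, which only records
`IsKaehlerManifold E M`. [cite: VoisinHodgeI2002, §3.1.1 Lemma 3.3, §3.1.2 Def. 3.6] -/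
theorem exists_isKaehler_kaehlerForm_eq_of_closed_positive_form (θ : MForm 𝓘(ℝ, E) M ℝ 2)
    (hs : IsSmoothForm θ) (hc : IsClosedForm θ)
    (hJ : ∀ (x : M) (v w : TangentSpace 𝓘(ℝ, E) x),
      θ x ![tangentJ E x v, tangentJ E x w] = θ x ![v, w])
    (hp : ∀ (x : M) (v : TangentSpace 𝓘(ℝ, E) x), v ≠ 0 → 0 < θ x ![v, tangentJ E x v]) :
    ∃ g : ContMDiffRiemannianMetric 𝓘(ℝ, E) ∞ E (fun x : M ↦ TangentSpace 𝓘(ℝ, E) x),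
      g.toRiemannianMetric.IsKaehler ∧ g.toRiemannianMetric.kaehlerForm = θ := by
  -- the coefficient forms `g₀ x (v, w) = θ x (v, Jw)`, built on the model fibre `E`
  let g₀ : ∀ x : M, TangentSpace 𝓘(ℝ, E) x →L[ℝ] TangentSpace 𝓘(ℝ, E) x →L[ℝ] ℝ :=
    fun x ↦ (twistBilin (E := E) (θ x :) :)
  have hg₀ : ∀ (x : M) (v w : TangentSpace 𝓘(ℝ, E) x), g₀ x v w = θ x ![v, tangentJ E x w] :=
    fun x v w ↦ rfl
  -- symmetry, from `J`-invariance and antisymmetry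
  have hsymm : ∀ (x : M) (v w : TangentSpace 𝓘(ℝ, E) x), g₀ x v w = g₀ x w v := by
    intro x v w
    rw [hg₀, hg₀, ← hJ x w (tangentJ E x v), tangentJ_tangentJ, cam₂_neg_right,
      cam₂_swap (θ x) (tangentJ E x w) v, neg_neg]
  -- smoothness, in the trivialization at `x₀`
  have hsmooth : ∀ x₀ : M, ContMDiffAt 𝓘(ℝ, E) (𝓘(ℝ, E).prod 𝓘(ℝ, E →L[ℝ] E →L[ℝ] ℝ)) ∞
      (fun x ↦ TotalSpace.mk' (E →L[ℝ] E →L[ℝ] ℝ) x (g₀ x)) x₀ := by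
    intro x₀
    rw [contMDiffAt_section, contMDiffAt_iff_source, contMDiffWithinAt_iff_contDiffWithinAt]
    -- on the chart target, the coordinate expression of `g₀` is `twistBilin ∘ θ.inChart x₀`
    have hev : ∀ y ∈ (extChartAt 𝓘(ℝ, E) x₀).target,
        ((fun x ↦ (trivializationAt (E →L[ℝ] E →L[ℝ] ℝ)
          (fun x : M ↦ TangentSpace 𝓘(ℝ, E) x →L[ℝ] TangentSpace 𝓘(ℝ, E) x →L[ℝ] ℝ) x₀
            ⟨x, g₀ x⟩).2) ∘ (extChartAt 𝓘(ℝ, E) x₀).symm) y = twistBilin (θ.inChart x₀ y) := by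
      intro y hy
      have hx : (extChartAt 𝓘(ℝ, E) x₀).symm y ∈ (chartAt E x₀).source := by
        rw [← extChartAt_source 𝓘(ℝ, E)]
        exact (extChartAt 𝓘(ℝ, E) x₀).map_target hy
      have hD : mfderivWithin 𝓘(ℝ, E) 𝓘(ℝ, E) (extChartAt 𝓘(ℝ, E) x₀).symm (range 𝓘(ℝ, E)) y =
          (trivializationAt E (TangentSpace 𝓘(ℝ, E)) x₀).symmL ℝ
            ((extChartAt 𝓘(ℝ, E) x₀).symm y) := by
        rw [TangentBundle.symmL_trivializationAt hx, (extChartAt 𝓘(ℝ, E) x₀).right_inv hy]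
      ext v w
      simp only [Function.comp_apply, twistBilin_apply]
      rw [trivializationAt_bilinForm_apply₂, hg₀, ← symmL_trivializationAt_I_smul hx,
        MForm.inChart_apply, hD]
      congr 1
      funext i
      fin_cases i <;> rfl
    refine ((contDiff_twistBilin (E := E)).contDiffAt.comp_contDiffWithinAt _
      (hs x₀)).congr_of_eventuallyEq ?_ (hev _ (mem_extChartAt_target x₀))
    exact Filter.eventuallyEq_of_mem (extChartAt_target_mem_nhdsWithin x₀) hev
  -- the metric
  let g : ContMDiffRiemannianMetric 𝓘(ℝ, E) ∞ E (fun x : M ↦ TangentSpace 𝓘(ℝ, E) x) :=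
    { inner := g₀
      symm := hsymm
      pos := fun x v hv ↦ hp x v hv
      isVonNBounded := fun x ↦ by
        change Bornology.IsVonNBounded ℝ {v : E | twistBilin (E := E) (θ x :) v v < 1}
        obtain ⟨c, hc0, hcv⟩ := exists_pos_mul_norm_sq_le (V := E) (twistBilin (E := E) (θ x :))
          (fun v hv ↦ hp x v hv)
        refine (NormedSpace.isVonNBounded_ball ℝ E (c⁻¹ + 1)).subset ?_
        intro v hv
        rw [Set.mem_setOf_eq] at hv
        rw [Metric.mem_ball, dist_zero_right]
        have h1 : c * ‖v‖ ^ 2 < 1 := (hcv v).trans_lt hv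
        have h2 : ‖v‖ ^ 2 < c⁻¹ := by
          have := mul_lt_mul_of_pos_left h1 (inv_pos.2 hc0)
          rwa [← mul_assoc, inv_mul_cancel₀ hc0.ne', one_mul, mul_one] at this
        by_cases h3 : ‖v‖ ≤ 1
        · have : (0 : ℝ) < c⁻¹ := inv_pos.2 hc0
          linarith
        · push Not at h3
          nlinarith [norm_nonneg v]
      contMDiff := hsmooth }
  -- Hermitian, with Kähler form `θ`
  have hHerm : g.toRiemannianMetric.IsHermitian := by
    intro x v w
    change g₀ x (tangentJ E x v) (tangentJ E x w) = g₀ x v w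
    rw [hg₀, hg₀]
    exact hJ x v (tangentJ E x w)
  have hform : g.toRiemannianMetric.kaehlerForm = θ := by
    funext x
    ext u
    rw [eq_vecCons_two u, Bundle.RiemannianMetric.kaehlerForm_apply_of_isHermitian _ hHerm]
    change g₀ x (tangentJ E x (u 0)) (u 1) = θ x ![u 0, u 1]
    rw [hg₀]
    exact hJ x (u 0) (u 1)
  exact ⟨g, ⟨hHerm, by rw [hform]; exact hc⟩, hform⟩

end Literature.Geometry.Kaehler

end
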